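import Mathlib
import Summits.Ventures.PercRepro2.SwOutCrossGenMarkQBit

/-!
# Two cross components as one fibre WITH THE MARK AT A DROPPED VERTEX OF THE FIRST: the joint
link label and the glued fibre (blind cell PercRepro2, night-4 g27, 2026-08-28;
proofs/NIGHT4-G27.md §2)

g25 glued a fibre `F₁` with the `KE` fields on a cross graph `G₁` and a further connected
component `G₂` into the fibre `fibKEESum` on `G₁ ⊕g G₂`, through the JOINT label (the `KE` label
of the sum at the glued point) as a `JointLabel`.  Here the first fibre carries g26's LINK label
of a mark `q : X₁` (`labelKEQ G₁ q`, the link order `BetterKEQ`), and the joint label is the link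
label of the sum at the glued point with the mark `Sum.inl q`: the `KE` label of the sum, the red
ports of the sum red-linked to the mark, the blue ports blue-linked to it.  A link between the
mark and a port of the SECOND component passes through `u` (`rlinkE_glue_inl_inr`), so it needs
both ends attached — which never happens where the product proof compares labels: at a uniform
(core) point of the second component its red ports are unattached and its blue ports unattached
in the flip (`labelKEQ_glue_core`: the joint link label is `gKEQ` of the first link label — no
link across), and along the slab injections the source has no red-side leak (a red port is
unattached) and the image no blue-side leak (`betterKEQ_glue`).  Hence **`jointKEQ`** is a
`JointLabel` for any first fibre with the link fields and a connected second component, and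
**`fibKEEQSum`** is the glued fibre on `FibKE (X₁ ⊕ X₂) (G₁ ⊕g G₂)` with the link fields of the
mark `Sum.inl q` again (so that it iterates, the mark staying in the first part).  Its inequality
is `SwOutCrossGenSumIneqQ`.
-/

namespace Summit.Ventures.PercRepro2

namespace CrossArm

open Classical

section GKEQ

variable {X₁ X₂ : Type*} (G₂ : SimpleGraph X₂)

/-- The joint link label at a uniform second component `c`, through the first link label `l`
(the mark in the first part): the joint `KE` label `gKE`, the links of the mark within the first
part, none across. -/
def gKEQ (l : LabelKEQ X₁) (c : FibKE X₂ G₂) : LabelKEQ (X₁ ⊕ X₂) :=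
  (gKE G₂ l.1 c, Sum.elim l.2.1 (fun _ => False), Sum.elim l.2.2 (fun _ => False))

/-- `gKEQ` is monotone in both arguments. -/
lemma gKEQ_mono {l l' : LabelKEQ X₁} {c c' : FibKE X₂ G₂} (h : BetterKEQ l' l)
    (hc : BetterKE (labelKE G₂ c') (labelKE G₂ c)) : BetterKEQ (gKEQ G₂ l' c') (gKEQ G₂ l c) := by
  refine ⟨gKE_mono G₂ h.1 hc, fun x hx => ?_, fun x hx => ?_⟩
  · rcases x with j | j
    · exact h.2.1 j hx
    · exact hx.elim
  · rcases x with j | j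
    · exact h.2.2 j hx
    · exact hx.elim

variable (G₁ : SimpleGraph X₁)

/-- **At a uniform second component the joint link label is `gKEQ` of the first link label**: no
link between the mark and a port of the uniform part. -/
lemma labelKEQ_glue_core (q : X₁) (w₁ : FibKE X₁ G₁) {c : FibKE X₂ G₂} (hc : coreKE c = true) :
    labelKEQ (G₁ ⊕g G₂) (Sum.inl q) (glueKE G₁ G₂ w₁ c) = gKEQ G₂ (labelKEQ G₁ q w₁) c := by
  refine Prod.ext (labelKE_glue_core G₂ G₁ w₁ hc) (Prod.ext ?_ ?_)
  · funext x
    rcases x with j | j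
    · show (w₁.2.2 j = false ∧ rlinkE (G₁ ⊕g G₂) (glueKE G₁ G₂ w₁ c) (Sum.inl q) (Sum.inl j)) =
        (w₁.2.2 j = false ∧ rlinkE G₁ w₁ q j)
      rw [rlinkE_glue_inl_inl]
    · show (c.2.2 j = false ∧ rlinkE (G₁ ⊕g G₂) (glueKE G₁ G₂ w₁ c) (Sum.inl q) (Sum.inr j)) =
        False
      rw [rlinkE_glue_inl_inr]
      apply propext
      exact ⟨fun h => not_attE_of_coreKE_red G₂ hc h.1 h.2.2, False.elim⟩
  · funext x
    rcases x with j | j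
    · show (w₁.2.2 j = true ∧ rlinkE (G₁ ⊕g G₂) (glueKE G₁ G₂ w₁ c).flip (Sum.inl q) (Sum.inl j)) =
        (w₁.2.2 j = true ∧ rlinkE G₁ w₁.flip q j)
      rw [← glueKE_flip, rlinkE_glue_inl_inl]
    · show (c.2.2 j = true ∧ rlinkE (G₁ ⊕g G₂) (glueKE G₁ G₂ w₁ c).flip (Sum.inl q) (Sum.inr j)) =
        False
      rw [← glueKE_flip, rlinkE_glue_inl_inr]
      apply propext
      exact ⟨fun h => not_attE_flip_of_coreKE_blue G₂ hc h.1 h.2.2, False.elim⟩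

/-- **The joint link label improves along a pair of component improvements** when the source has
no red-side leak (its red ports are unattached, so no link between the mark and a red port of the
second part) and the image has no blue-side leak (no blue link between the mark and a blue port
of the second part). -/
lemma betterKEQ_glue (q : X₁) {w₁ w₁' : FibKE X₁ G₁} {w₂ w₂' : FibKE X₂ G₂}
    (h₁ : BetterKEQ (labelKEQ G₁ q w₁') (labelKEQ G₁ q w₁))
    (h₂ : BetterKE (labelKE G₂ w₂') (labelKE G₂ w₂))
    (hs₁ : leakKE G₁ w₁ = false) (hs₂ : leakKE G₂ w₂ = false)
    (ht₁ : leakKE G₁ w₁'.flip = false) (ht₂ : leakKE G₂ w₂'.flip = false) :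
    BetterKEQ (labelKEQ (G₁ ⊕g G₂) (Sum.inl q) (glueKE G₁ G₂ w₁' w₂'))
      (labelKEQ (G₁ ⊕g G₂) (Sum.inl q) (glueKE G₁ G₂ w₁ w₂)) := by
  refine ⟨betterKE_glue G₂ G₁ h₁.1 h₂ hs₁ hs₂ ht₁ ht₂, fun x hx => ?_, fun x hx => ?_⟩
  · rcases x with j | j
    · have hj : w₁.2.2 j = false := hx.1
      have hl : rlinkE (G₁ ⊕g G₂) (glueKE G₁ G₂ w₁ w₂) (Sum.inl q) (Sum.inl j) := hx.2
      rw [rlinkE_glue_inl_inl] at hl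
      obtain ⟨hj', hl'⟩ := h₁.2.1 j ⟨hj, hl⟩
      exact ⟨hj', (rlinkE_glue_inl_inl G₁ G₂ w₁' w₂' q j).2 hl'⟩
    · exfalso
      have hj : w₂.2.2 j = false := hx.1
      have hl : rlinkE (G₁ ⊕g G₂) (glueKE G₁ G₂ w₁ w₂) (Sum.inl q) (Sum.inr j) := hx.2
      rw [rlinkE_glue_inl_inr] at hl
      rw [leakKE_eq_false_iff] at hs₂
      rw [hs₂ j hl.2] at hj
      exact Bool.noConfusion hj
  · rcases x with j | j
    · have hj : w₁'.2.2 j = true := hx.1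
      have hl : rlinkE (G₁ ⊕g G₂) (glueKE G₁ G₂ w₁' w₂').flip (Sum.inl q) (Sum.inl j) := hx.2
      rw [← glueKE_flip, rlinkE_glue_inl_inl] at hl
      obtain ⟨hj', hl'⟩ := h₁.2.2 j ⟨hj, hl⟩
      refine ⟨hj', ?_⟩
      rw [← glueKE_flip, rlinkE_glue_inl_inl]
      exact hl'
    · exfalso
      have hj : w₂'.2.2 j = true := hx.1
      have hl : rlinkE (G₁ ⊕g G₂) (glueKE G₁ G₂ w₁' w₂').flip (Sum.inl q) (Sum.inr j) := hx.2
      rw [← glueKE_flip, rlinkE_glue_inl_inr] at hl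
      rw [leakKE_eq_false_iff] at ht₂
      have h' : (!w₂'.2.2 j) = true := ht₂ j hl.2
      rw [hj] at h'
      exact Bool.noConfusion h'

end GKEQ

section Joint

variable {X₁ X₂ : Type*} {G₁ : SimpleGraph X₁} (G₂ : SimpleGraph X₂) [Fintype X₂] [DecidableEq X₂]
  [DecidableRel G₂.Adj] [Nonempty X₂] (hG₂ : G₂.Connected) (q : X₁)
  (F₁ : FibreIter (FibKE X₁ G₁) (AtomKEE X₁ G₁) (LabelKEQ X₁))
  (hflip : F₁.flip = FibKE.flip) (hleak : F₁.leakR = leakKE G₁)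
  (hlab : F₁.label = labelKEQ G₁ q) (hB : F₁.BetterL = BetterKEQ)

include hflip hleak hlab hB

/-- **The joint link label of two components at one junction with the mark in the first** (the
link label of the sum graph at the glued point, mark `Sum.inl q`) is a `JointLabel`. -/
noncomputable def jointKEQ : JointLabel F₁ (fibKEEBit G₂ hG₂) (LabelKEQ (X₁ ⊕ X₂)) where
  labelJ := fun w₁ w₂ => labelKEQ (G₁ ⊕g G₂) (Sum.inl q) (glueKE G₁ G₂ w₁ w₂)
  BetterJ := BetterKEQ
  betterJ_refl := BetterKEQ_refl
  g := fun l c => gKEQ G₂ l c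
  labelJ_core := fun w₁ c hc => by
    rw [hlab]
    exact labelKEQ_glue_core G₂ G₁ q w₁ hc
  g_mono := fun l l' c _ h => by
    rw [hB] at h
    exact gKEQ_mono G₂ h (BetterKE_refl _)
  pairJ := fun w₁ c hc => by
    have hc0 : coreKE c = true := core0KE_core G₂ c hc
    have hc1 : coreKE c.flip = true := coreKE_flip c hc0
    show BetterKEQ (labelKEQ (G₁ ⊕g G₂) (Sum.inl q) (glueKE G₁ G₂ w₁ c))
      (labelKEQ (G₁ ⊕g G₂) (Sum.inl q) (glueKE G₁ G₂ w₁ c.flip))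
    rw [labelKEQ_glue_core G₂ G₁ q w₁ hc0, labelKEQ_glue_core G₂ G₁ q w₁ hc1]
    exact gKEQ_mono G₂ (BetterKEQ_refl _) (pair_labelKE G₂ c hc)
  ncJ := fun w₁ w₂ h₁ h₂ hc => by
    have h₁' : leakKE G₁ w₁ = false := by rw [← hleak]; exact h₁
    obtain ⟨ht₁, hl₁, -⟩ := F₁.theta_ok w₁ h₁
    rw [hleak, hflip] at ht₁
    rw [hlab, hB] at hl₁
    obtain ⟨ht₂, -, hl₂, -⟩ := psiKE_ok G₂ w₂ h₂ hc
    exact betterKEQ_glue G₂ G₁ q hl₁ hl₂ h₁' h₂ ht₁ ht₂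
  thetaJ := fun w₁ w₂ h₁ h₂ => by
    have h₁' : leakKE G₁ w₁ = false := by rw [← hleak]; exact h₁
    obtain ⟨ht₁, hl₁, -⟩ := F₁.theta_ok w₁ h₁
    rw [hleak, hflip] at ht₁
    rw [hlab, hB] at hl₁
    obtain ⟨ht₂, hl₂, -⟩ := thetaKE_ok G₂ w₂ h₂
    exact betterKEQ_glue G₂ G₁ q hl₁ hl₂ h₁' h₂ ht₁ ht₂

omit [Fintype X₂] [DecidableEq X₂] [DecidableRel G₂.Adj] hleak hlab hB in
/-- The red edge atoms of a glued point are carried by the flip of `theta₁ × theta₂` (the first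
fibre with the link fields). -/
lemma redKEE_glue_thetaQ {w₁ : FibKE X₁ G₁} {w₂ : FibKE X₂ G₂} (h₁ : F₁.leakR w₁ = false)
    (h₂ : leakKE G₂ w₂ = false) (hred : F₁.red = redKEE G₁)
    (a : AtomKEE (X₁ ⊕ X₂) (G₁ ⊕g G₂))
    (ha : redKEE (G₁ ⊕g G₂) (glueKE G₁ G₂ w₁ w₂) a = true) :
    redKEE (G₁ ⊕g G₂) (glueKE G₁ G₂ (F₁.theta w₁) (thetaKE G₂ w₂)).flip a = true := by
  obtain ⟨-, -, hr₁⟩ := F₁.theta_ok w₁ h₁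
  rw [hred, hflip] at hr₁
  obtain ⟨-, -, hr₂⟩ := thetaKE_ok G₂ w₂ h₂
  rw [← glueKE_flip]
  rcases a with (i | i) | s
  · rw [redKEE_glue_inl] at ha ⊢
    exact hr₁ _ ha
  · rw [redKEE_glue_inr] at ha ⊢
    exact hr₂ _ ha
  · obtain ⟨s', rfl⟩ := (SimpleGraph.edgeSetSumEquiv (G := G₁) (H := G₂)).symm.surjective s
    rcases s' with s₁ | s₂
    · rw [redKEE_glue_edge_inl] at ha ⊢
      exact hr₁ _ ha
    · rw [redKEE_glue_edge_inr] at ha ⊢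
      exact hr₂ _ ha

/-- **The glued fibre of two components with the mark in the first**, with the link fields of the
mark `Sum.inl q` and the injection `theta₁ × thetaKE` through the gluing. -/
noncomputable def fibKEEQSum (hred : F₁.red = redKEE G₁) :
    FibreIter (FibKE (X₁ ⊕ X₂) (G₁ ⊕g G₂)) (AtomKEE (X₁ ⊕ X₂) (G₁ ⊕g G₂))
      (LabelKEQ (X₁ ⊕ X₂)) where
  flip := FibKE.flip
  flip_flip := FibKE.flip_flip
  red := redKEE (G₁ ⊕g G₂)
  leakR := leakKE (G₁ ⊕g G₂)
  label := labelKEQ (G₁ ⊕g G₂) (Sum.inl q)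
  BetterL := BetterKEQ
  betterL_refl := BetterKEQ_refl
  theta := fun w => glueKE G₁ G₂ (F₁.theta (splitKE G₁ G₂ w).1) (thetaKE G₂ (splitKE G₁ G₂ w).2)
  theta_ok := fun w hw => by
    have hw' : w = glueKE G₁ G₂ (splitKE G₁ G₂ w).1 (splitKE G₁ G₂ w).2 :=
      (glueKE_splitKE G₁ G₂ w).symm
    set w₁ := (splitKE G₁ G₂ w).1
    set w₂ := (splitKE G₁ G₂ w).2
    rw [hw', leakKE_glue, Bool.or_eq_false_iff] at hw
    obtain ⟨h₁, h₂⟩ := hw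
    have h₁' : F₁.leakR w₁ = false := by rw [hleak]; exact h₁
    obtain ⟨ht₁, hl₁, -⟩ := F₁.theta_ok w₁ h₁'
    rw [hleak, hflip] at ht₁
    rw [hlab, hB] at hl₁
    obtain ⟨ht₂, hl₂, -⟩ := thetaKE_ok G₂ w₂ h₂
    refine ⟨?_, ?_, ?_⟩
    · rw [← glueKE_flip, leakKE_glue, ht₁, ht₂]; rfl
    · rw [hw']
      exact betterKEQ_glue G₂ G₁ q hl₁ hl₂ h₁ h₂ ht₁ ht₂
    · intro a ha
      rw [hw'] at ha
      exact redKEE_glue_thetaQ G₂ F₁ hflip h₁' h₂ hred a ha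
  theta_inj := fun w w' hw hw' heq => by
    have e : ∀ v : FibKE (X₁ ⊕ X₂) (G₁ ⊕g G₂),
        v = glueKE G₁ G₂ (splitKE G₁ G₂ v).1 (splitKE G₁ G₂ v).2 :=
      fun v => (glueKE_splitKE G₁ G₂ v).symm
    have hw1 := hw
    have hw1' := hw'
    rw [e w, leakKE_glue, Bool.or_eq_false_iff] at hw1
    rw [e w', leakKE_glue, Bool.or_eq_false_iff] at hw1'
    have hs := congrArg (splitKE G₁ G₂) heq
    rw [splitKE_glueKE, splitKE_glueKE, Prod.mk.injEq] at hs
    have h1 : (splitKE G₁ G₂ w).1 = (splitKE G₁ G₂ w').1 :=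
      F₁.theta_inj _ _ (by rw [hleak]; exact hw1.1) (by rw [hleak]; exact hw1'.1) hs.1
    have h2 : (splitKE G₁ G₂ w).2 = (splitKE G₁ G₂ w').2 :=
      thetaKE_inj G₂ _ _ hw1.2 hw1'.2 hs.2
    rw [e w, e w', h1, h2]

end Joint

end CrossArm

end Summit.Ventures.PercRepro2
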